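import Mathlib
import Summits.HodgeConjecture.CorCM.RMuNormFixedUnits
import Summits.HodgeConjecture.CorCM.RMuNormOddUnit
import HarnessLib

/-!
# Hermitian units of `K ⊗ E` are norms when `E` contains the conjugates of a `ρ`-stable subfield

Let `F` be a field with `2 ≠ 0`, `K` a commutative `F`-algebra with an `F`-endomorphism `ρ`
(think: a CM field with its complex conjugation), and `E / F` a field extension. On
`L := K ⊗_F E` let `ρ̃ := ρ ⊗ 1`; its fixed ring `T` plays the role of `K⁺ ⊗_F E`, and the
*hermitian units* of `L` are the `ρ̃`-fixed units. The obstruction group `T^× / N(L^×)`,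
`N(a) = a · ρ̃(a)`, controls e.g. whether an anti-hermitian unit `β₀ ∈ L^×` (`ρ̃ β₀ = -β₀`) can be
normalised to `β ⊗ 1` with `β ∈ K` anti-invariant (`ρ β = -β`) by a change of generator
`β₀ ↦ a ρ̃(a) β₀`.

**Theorem** (`exists_isUnit_mul_conj_eq`, `exists_eq_tmul_mul_norm`). Suppose there is a finite
extension `k₁ / F` with a non-trivial `F`-involution `c` and an `F`-algebra map `i : k₁ → K`
with `ρ ∘ i = i ∘ c`, and that `E` contains all conjugates of `k₁`
(`#Hom_F(k₁, E) = [k₁ : F]`; automatic when `E / F` is normal and receives one embedding of a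
separable `k₁`, `…_of_normal`). Then EVERY hermitian unit of `K ⊗_F E` is a norm `a · ρ̃(a)`
(`a` a unit), and every anti-hermitian unit is `(β ⊗ 1) · a · ρ̃(a)` with `β ∈ K`, `ρ β = -β`,
`β ≠ 0` — for any prescribed such `β` when `K` is a field (`exists_isUnit_eq_tmul_mul_norm`).

Proof: `k₁ ⊗_F E ≅ E^{Hom_F(k₁,E)}` and `c` permutes the factors by the fixed-point-free
involution `σ ↦ σ ∘ c`, which yields `u ∈ K ⊗_F E` with `u² = 1`, `ρ̃ u = -u`
(`RMuNorm.exists_sq_eq_one_map_eq_neg_of_intertwines` of `CorCM/RMuNormOddUnit.lean`,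
transported along `Algebra.TensorProduct.comm`); then `f = (1 + u)/2` is an idempotent with
`ρ̃ f = 1 - f` and `RMuNorm.exists_isUnit_mul_map_eq` (`CorCM/RMuNormFixedUnits.lean`) applies:
`t = a ρ̃(a)` with `a = f t + (1 - f)`.

Application (the reason this file exists; stated here, not formalised — the tree has no algebraic
de Rham homology over a number field). In Y. Liu, *Fourier–Jacobi cycles and arithmetic relative
trace formula*, Camb. J. Math. 9 (2021), Def. 4.5 (2), a CM datum for a weight-one conjugate
symplectic character `μ` of the CM extension `E/F⁺` carries a rigidification
`r_μ : M_μ ⊗_ℚ E ≅ H₁^dR(A_μ/E)` whose `λ_μ`-pairing must be `Tr(x β ȳ)` with `β ∈ M_μ`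
(TeX l. 1957); Liu: «the existence of `r_μ` is obvious» (l. 1982). Since `H₁^dR(A_μ/E)` is free
of rank one over `L = M_μ ⊗_ℚ E` and the pairing is `Tr_{L/E}(x β₀ ȳ)` for an anti-hermitian unit
`β₀`, `r_μ` exists iff `β₀ ∈ (M_μ^- ⊗ 1) · N(L^×) · E^×`. With `K = M_μ`, `ρ` = complex
conjugation, `k₁ = M'_μ` = the reflex field of `(E, Φ_μ)` (`M'_μ ⊆ M_μ`, l. 1919/1928, stable
under conjugation) and `E` GALOIS over `ℚ` (so `E ⊇` all conjugates of `M'_μ ⊆ E`), the theorem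
gives `N(L^×) = T^×`: the obstruction vanishes at every CM type `Φ_μ`, primitive or not. This is
the case of the CorCM displays (`IsGalois ℚ F`, Liu's `E` = the tree's `F`), and answers the
question left open in the cell's alternative-input census for the token `R` (non-primitive
faces). For non-normal `E` not containing the conjugates of `M'_μ` nothing is claimed.

Cell pub-hodgecm2, lane RMU-NORM (count-neutral; nothing here touches the COR-CM chain, the E
term, B01 or the S7 displays; HC_CM is NOT proved). The Liu-level statement (`K = M_μ`,
`k₁ = M'_μ`, `[IsGalois ℚ F]`) is filed ONCE, by seat hcmisog-isog-2, as
`Literature/NumberTheory/Automorphic/Liu2021/Def45RMuGalois.lean` (see also there); this file is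
the general-algebra layer and states no `Def45`-level theorem. Elementary algebra; no named
facts. [folklore]
-/

open scoped TensorProduct

namespace Summit.HodgeConjecture.CorCM.RMuNorm

open Module Algebra.TensorProduct

section CommRing

variable {F : Type*} [Field F] {K : Type*} [CommRing K] [Algebra F K]
  {k₁ : Type*} [Field k₁] [Algebra F k₁] {E : Type*} [Field E] [Algebra F E]

/-- The flip `K ⊗ E ≅ E ⊗ K` intertwines `ρ ⊗ 1` with `1 ⊗ ρ`. [folklore] -/
theorem comm_map_conj (ρ : K →ₐ[F] K) (z : K ⊗[F] E) :
    Algebra.TensorProduct.comm F K E (Algebra.TensorProduct.map ρ (AlgHom.id F E) z) =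
      Algebra.TensorProduct.map (AlgHom.id E E) ρ (Algebra.TensorProduct.comm F K E z) := by
  induction z using TensorProduct.induction_on with
  | zero => simp only [map_zero]
  | tmul x a =>
    rw [Algebra.TensorProduct.map_tmul, Algebra.TensorProduct.comm_tmul,
      Algebra.TensorProduct.comm_tmul, Algebra.TensorProduct.map_tmul]
    rfl
  | add z w hz hw => simp only [map_add, hz, hw]

/-- **An anti-hermitian square root of unity in `K ⊗_F E`.** Under the standing hypotheses
(`c` a non-trivial involution of the finite extension `k₁/F`, `i : k₁ → K` intertwining `c`
and `ρ`, `E` containing all conjugates of `k₁`) there is `u ∈ K ⊗_F E` with `u² = 1` and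
`(ρ ⊗ 1) u = -u`. [folklore] -/
theorem exists_sq_eq_one_conj_eq_neg [FiniteDimensional F k₁] (ρ : K →ₐ[F] K)
    (c : k₁ →ₐ[F] k₁) (hc : c ≠ AlgHom.id F k₁) (hcc : ∀ x, c (c x) = x) (i : k₁ →ₐ[F] K)
    (hρi : ∀ x, ρ (i x) = i (c x)) (hE : Fintype.card (k₁ →ₐ[F] E) = finrank F k₁) :
    ∃ u : K ⊗[F] E, u * u = 1 ∧ Algebra.TensorProduct.map ρ (AlgHom.id F E) u = -u := by
  obtain ⟨u, hu, hρu⟩ :=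
    exists_sq_eq_one_map_eq_neg_of_intertwines (E := E) i ρ c hc hcc hρi hE
  let θ := Algebra.TensorProduct.comm F K E
  refine ⟨θ.symm u, ?_, ?_⟩
  · rw [← map_mul, hu, map_one]
  · apply θ.injective
    rw [comm_map_conj, AlgEquiv.apply_symm_apply, map_neg, AlgEquiv.apply_symm_apply, hρu]

/-- `2` is invertible in `K ⊗_F E` when `2 ≠ 0` in `F`. [folklore] -/
theorem isUnit_two [NeZero (2 : F)] : IsUnit (2 : K ⊗[F] E) := by
  have h : IsUnit (algebraMap F (K ⊗[F] E) 2) := (IsUnit.mk0 (2 : F) (NeZero.ne 2)).map _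
  rwa [map_ofNat] at h

/-- **Hermitian units of `K ⊗_F E` are norms.** Let `2 ≠ 0` in `F`; let `ρ` be an
`F`-endomorphism of the commutative `F`-algebra `K` which restricts, along an `F`-algebra map
`i : k₁ → K`, to a non-trivial involution `c` of a finite extension `k₁/F`; and let the field
`E ⊇ F` contain all conjugates of `k₁` (`#Hom_F(k₁, E) = [k₁ : F]`). Then every unit `t` of
`K ⊗_F E` fixed by `ρ ⊗ 1` is of the form `a · (ρ ⊗ 1)(a)` with `a` a unit: the norm map
`(K ⊗_F E)^× → ((K ⊗_F E)^{ρ ⊗ 1})^×` is surjective. [folklore] -/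
theorem exists_isUnit_mul_conj_eq [NeZero (2 : F)] [FiniteDimensional F k₁] (ρ : K →ₐ[F] K)
    (c : k₁ →ₐ[F] k₁) (hc : c ≠ AlgHom.id F k₁) (hcc : ∀ x, c (c x) = x) (i : k₁ →ₐ[F] K)
    (hρi : ∀ x, ρ (i x) = i (c x)) (hE : Fintype.card (k₁ →ₐ[F] E) = finrank F k₁)
    {t : K ⊗[F] E} (ht : IsUnit t) (hfix : Algebra.TensorProduct.map ρ (AlgHom.id F E) t = t) :
    ∃ a : K ⊗[F] E, IsUnit a ∧ a * Algebra.TensorProduct.map ρ (AlgHom.id F E) a = t := by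
  obtain ⟨u, hu, hρu⟩ := exists_sq_eq_one_conj_eq_neg (E := E) ρ c hc hcc i hρi hE
  haveI : Invertible (2 : K ⊗[F] E) := (isUnit_two (K := K) (E := E)).invertible
  exact exists_isUnit_mul_map_eq_of_sq_eq_one
    (Algebra.TensorProduct.map ρ (AlgHom.id F E)).toRingHom hu hρu ht hfix

/-- **Anti-hermitian units differ by norms.** Same hypotheses; if `β₀, β₁` are units of
`K ⊗_F E` with `(ρ ⊗ 1) βᵢ = -βᵢ`, then `β₀ = β₁ · (a · (ρ ⊗ 1) a)` for a unit `a`.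
[folklore] -/
theorem exists_isUnit_eq_mul_norm_of_conj_eq_neg [NeZero (2 : F)] [FiniteDimensional F k₁]
    (ρ : K →ₐ[F] K) (c : k₁ →ₐ[F] k₁) (hc : c ≠ AlgHom.id F k₁) (hcc : ∀ x, c (c x) = x)
    (i : k₁ →ₐ[F] K) (hρi : ∀ x, ρ (i x) = i (c x))
    (hE : Fintype.card (k₁ →ₐ[F] E) = finrank F k₁) {β₀ β₁ : K ⊗[F] E} (hβ₀ : IsUnit β₀)
    (hρβ₀ : Algebra.TensorProduct.map ρ (AlgHom.id F E) β₀ = -β₀) (hβ₁ : IsUnit β₁)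
    (hρβ₁ : Algebra.TensorProduct.map ρ (AlgHom.id F E) β₁ = -β₁) :
    ∃ a : K ⊗[F] E, IsUnit a ∧ β₀ = β₁ * (a * Algebra.TensorProduct.map ρ (AlgHom.id F E) a) := by
  obtain ⟨u, hu, hρu⟩ := exists_sq_eq_one_conj_eq_neg (E := E) ρ c hc hcc i hρi hE
  haveI : Invertible (2 : K ⊗[F] E) := (isUnit_two (K := K) (E := E)).invertible
  exact exists_isUnit_eq_mul_norm_of_sq_eq_one
    (Algebra.TensorProduct.map ρ (AlgHom.id F E)).toRingHom hu hρu hβ₀ hρβ₀ hβ₁ hρβ₁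

end CommRing

section Field

variable {F : Type*} [Field F] {K : Type*} [Field K] [Algebra F K]
  {k₁ : Type*} [Field k₁] [Algebra F k₁] {E : Type*} [Field E] [Algebra F E]

/-- A non-zero anti-invariant element of `K` exists as soon as `ρ` restricts to a non-trivial
involution `c` along an injective `i : k₁ → K`: `β = i x - ρ (i x)` for any `x` moved by `c`
(then `ρ β = i (c x) - i (c (c x)) = -β`). [folklore] -/
theorem exists_ne_zero_map_eq_neg (ρ : K →ₐ[F] K) (c : k₁ →ₐ[F] k₁) (hc : c ≠ AlgHom.id F k₁)
    (hcc : ∀ x, c (c x) = x) (i : k₁ →ₐ[F] K) (hρi : ∀ x, ρ (i x) = i (c x)) :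
    ∃ β : K, β ≠ 0 ∧ ρ β = -β := by
  obtain ⟨x, hx⟩ : ∃ x, c x ≠ x := by
    by_contra h
    push Not at h
    exact hc (AlgHom.ext h)
  refine ⟨i x - ρ (i x), ?_, ?_⟩
  · rw [hρi, sub_ne_zero]
    exact fun h => hx (i.toRingHom.injective h).symm
  · rw [map_sub, hρi, hρi, hcc, neg_sub]

/-- For `β ∈ K^×` with `ρ β = -β`, the element `β ⊗ 1` is an anti-hermitian unit of `K ⊗_F E`.
[folklore] -/
theorem isUnit_tmul_one_and_conj (ρ : K →ₐ[F] K) {β : K} (hβ0 : β ≠ 0) (hβ : ρ β = -β) :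
    IsUnit (β ⊗ₜ[F] (1 : E)) ∧
      Algebra.TensorProduct.map ρ (AlgHom.id F E) (β ⊗ₜ[F] (1 : E)) = -(β ⊗ₜ[F] (1 : E)) := by
  refine ⟨?_, ?_⟩
  · have h := (IsUnit.mk0 β hβ0).map (Algebra.TensorProduct.includeLeft (R := F) (S := F)
      (A := K) (B := E))
    rwa [Algebra.TensorProduct.includeLeft_apply] at h
  · rw [Algebra.TensorProduct.map_tmul, hβ, AlgHom.id_apply, TensorProduct.neg_tmul]

/-- **Normal form of anti-hermitian units, prescribed `β`.** Let `2 ≠ 0` in `F`, `K` a field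
with an `F`-endomorphism `ρ` restricting along `i : k₁ → K` to a non-trivial involution `c` of a
finite extension `k₁/F`, and `E ⊇ F` a field containing all conjugates of `k₁`. For every
`β ∈ K`, `β ≠ 0`, `ρ β = -β`, every unit `β₀ ∈ K ⊗_F E` with `(ρ ⊗ 1) β₀ = -β₀` is
`β₀ = (β ⊗ 1) · (a · (ρ ⊗ 1) a)` for some unit `a`. [folklore] -/
theorem exists_isUnit_eq_tmul_mul_norm [NeZero (2 : F)] [FiniteDimensional F k₁]
    (ρ : K →ₐ[F] K) (c : k₁ →ₐ[F] k₁) (hc : c ≠ AlgHom.id F k₁) (hcc : ∀ x, c (c x) = x)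
    (i : k₁ →ₐ[F] K) (hρi : ∀ x, ρ (i x) = i (c x))
    (hE : Fintype.card (k₁ →ₐ[F] E) = finrank F k₁) {β : K} (hβ0 : β ≠ 0) (hβ : ρ β = -β)
    {β₀ : K ⊗[F] E} (hβ₀ : IsUnit β₀)
    (hρβ₀ : Algebra.TensorProduct.map ρ (AlgHom.id F E) β₀ = -β₀) :
    ∃ a : K ⊗[F] E, IsUnit a ∧
      β₀ = (β ⊗ₜ[F] (1 : E)) * (a * Algebra.TensorProduct.map ρ (AlgHom.id F E) a) := by
  obtain ⟨h1, h2⟩ := isUnit_tmul_one_and_conj (E := E) ρ hβ0 hβ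
  exact exists_isUnit_eq_mul_norm_of_conj_eq_neg ρ c hc hcc i hρi hE hβ₀ hρβ₀ h1 h2

/-- **Normal form of anti-hermitian units** (the shape of the rigidification `r_μ` of
[Liu 2021, Def. 4.5 (2)] discussed in the module docstring). Let `2 ≠ 0` in `F`, `K` a field
with an `F`-endomorphism `ρ` restricting along `i : k₁ → K` to a non-trivial involution `c` of
a finite extension `k₁/F`, and `E ⊇ F` a field containing all conjugates of `k₁`. Then every
unit `β₀` of `K ⊗_F E` with `(ρ ⊗ 1) β₀ = -β₀` can be written
`β₀ = (β ⊗ 1) · a · (ρ ⊗ 1)(a)` with `β ∈ K`, `ρ β = -β`, `β ≠ 0`, and `a` a unit. [folklore] -/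
theorem exists_eq_tmul_mul_norm [NeZero (2 : F)] [FiniteDimensional F k₁] (ρ : K →ₐ[F] K)
    (c : k₁ →ₐ[F] k₁) (hc : c ≠ AlgHom.id F k₁) (hcc : ∀ x, c (c x) = x) (i : k₁ →ₐ[F] K)
    (hρi : ∀ x, ρ (i x) = i (c x)) (hE : Fintype.card (k₁ →ₐ[F] E) = finrank F k₁)
    {β₀ : K ⊗[F] E} (hβ₀ : IsUnit β₀)
    (hρβ₀ : Algebra.TensorProduct.map ρ (AlgHom.id F E) β₀ = -β₀) :
    ∃ (β : K) (a : K ⊗[F] E), ρ β = -β ∧ β ≠ 0 ∧ IsUnit a ∧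
      β₀ = (β ⊗ₜ[F] (1 : E)) * a * Algebra.TensorProduct.map ρ (AlgHom.id F E) a := by
  obtain ⟨β, hβ0, hβ⟩ := exists_ne_zero_map_eq_neg ρ c hc hcc i hρi
  obtain ⟨a, ha, h⟩ := exists_isUnit_eq_tmul_mul_norm (E := E) ρ c hc hcc i hρi hE hβ0 hβ hβ₀ hρβ₀
  exact ⟨β, a, hβ, hβ0, ha, by rw [h, mul_assoc]⟩

/-- **Normal form of anti-hermitian units, normal `E`.** As `exists_eq_tmul_mul_norm`, with the
conjugates hypothesis supplied by: `E/F` normal, `k₁/F` separable, and one `F`-embedding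
`j : k₁ → E`. (For `F = ℚ`: `E` a Galois number field containing a copy of `k₁`.) [folklore] -/
theorem exists_eq_tmul_mul_norm_of_normal [NeZero (2 : F)] [FiniteDimensional F k₁]
    [Algebra.IsSeparable F k₁] [Normal F E] (j : k₁ →ₐ[F] E) (ρ : K →ₐ[F] K)
    (c : k₁ →ₐ[F] k₁) (hc : c ≠ AlgHom.id F k₁) (hcc : ∀ x, c (c x) = x) (i : k₁ →ₐ[F] K)
    (hρi : ∀ x, ρ (i x) = i (c x)) {β₀ : K ⊗[F] E} (hβ₀ : IsUnit β₀)
    (hρβ₀ : Algebra.TensorProduct.map ρ (AlgHom.id F E) β₀ = -β₀) :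
    ∃ (β : K) (a : K ⊗[F] E), ρ β = -β ∧ β ≠ 0 ∧ IsUnit a ∧
      β₀ = (β ⊗ₜ[F] (1 : E)) * a * Algebra.TensorProduct.map ρ (AlgHom.id F E) a :=
  exists_eq_tmul_mul_norm ρ c hc hcc i hρi (card_algHom_eq_finrank_of_normal j) hβ₀ hρβ₀

/-- **Hermitian units are norms, normal `E`.** As `exists_isUnit_mul_conj_eq`, with the
conjugates hypothesis supplied by: `E/F` normal, `k₁/F` separable, and one `F`-embedding
`j : k₁ → E`. [folklore] -/
theorem exists_isUnit_mul_conj_eq_of_normal [NeZero (2 : F)] [FiniteDimensional F k₁]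
    [Algebra.IsSeparable F k₁] [Normal F E] (j : k₁ →ₐ[F] E) (ρ : K →ₐ[F] K)
    (c : k₁ →ₐ[F] k₁) (hc : c ≠ AlgHom.id F k₁) (hcc : ∀ x, c (c x) = x) (i : k₁ →ₐ[F] K)
    (hρi : ∀ x, ρ (i x) = i (c x)) {t : K ⊗[F] E} (ht : IsUnit t)
    (hfix : Algebra.TensorProduct.map ρ (AlgHom.id F E) t = t) :
    ∃ a : K ⊗[F] E, IsUnit a ∧ a * Algebra.TensorProduct.map ρ (AlgHom.id F E) a = t :=
  exists_isUnit_mul_conj_eq ρ c hc hcc i hρi (card_algHom_eq_finrank_of_normal j) ht hfix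

/-- **The self-split case** (`k₁ = K`): if `ρ` is a non-trivial `F`-involution of a finite
separable extension `K/F` and the normal extension `E/F` receives an embedding of `K`, then every
hermitian unit of `K ⊗_F E` is a norm. (With `F = ℚ`, `K` a CM field, `ρ` = complex
conjugation, `E` a Galois number field containing a copy of `K`.) [folklore] -/
theorem exists_isUnit_mul_conj_eq_of_normal_self [NeZero (2 : F)] [FiniteDimensional F K]
    [Algebra.IsSeparable F K] [Normal F E] (j : K →ₐ[F] E) (ρ : K →ₐ[F] K)
    (hρ : ρ ≠ AlgHom.id F K) (hρρ : ∀ x, ρ (ρ x) = x) {t : K ⊗[F] E} (ht : IsUnit t)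
    (hfix : Algebra.TensorProduct.map ρ (AlgHom.id F E) t = t) :
    ∃ a : K ⊗[F] E, IsUnit a ∧ a * Algebra.TensorProduct.map ρ (AlgHom.id F E) a = t :=
  exists_isUnit_mul_conj_eq_of_normal j ρ ρ hρ hρρ (AlgHom.id F K) (fun _ => rfl) ht hfix

end Field

end Summit.HodgeConjecture.CorCM.RMuNorm
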